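import Mathlib
import Literature.NumberTheory.Transcendental.LindemannWeierstrassProofs
import HarnessLib

/-!
# Ably's measure of algebraic independence for `e^{y₁}, …, e^{yₙ}` — proofs, part 0: the qualitative shadow and the degenerate ranges

`Literature/NumberTheory/Transcendental/LindemannWeierstrassMeasureProofs.lean` — sibling PROOFS
file of `LindemannWeierstrassMeasure.lean` (the named fact
`Literature.NumberTheory.Transcendental.Ably1994_lindemannWeierstrass_measure`: M. Ably, *Une
version quantitative du théorème de Lindemann–Weierstrass*, Acta Arith. 67 (1994) 29–45,
Théorème p. 30). Everything here is PROVED; no definitions, no named facts, nothing asserted about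
the fact itself (this part does not need to import the fact file: its lemmas are about the
objects of the statement — `MvPolynomial.aeval (fun i ↦ cexp (y i)) P`, the coefficient bound,
the left-hand side — not about the `Prop` it defines).

The printed proof (Ably, §§I–III) obtains the measure from Jabbouri's quantitative version of
Philippon's criterion for algebraic independence (§I, "Critère", p. 31) fed with a family of
auxiliary polynomials built by Gel'fond's method (§II, "Proposition principale", pp. 33–41: Siegel's
lemma, Diaz's modification, an extrapolation, Philippon's zero estimate on `𝔾ₐ × 𝔾ₘ`) and a choice
of parameters (§III, pp. 42–44). This first part records what the tree already gives towards it: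

* `aeval_cexp_ne_zero`, `norm_aeval_cexp_pos` — the SIGN of the theorem: for `ℚ`-linearly
  independent algebraic `y` and a non-zero `P ∈ ℤ[X₁, …, Xₙ]`, `P(e^{y₁}, …, e^{yₙ}) ≠ 0`. This is
  the Lindemann–Weierstrass theorem itself (Weierstrass' form), PROVED in the tree
  (`LindemannWeierstrass.AlgIndep_holds`, `LindemannWeierstrassProofs.lean`); the measure is its
  quantitative refinement ("Ce théorème, appelé théorème de Lindemann–Weierstrass …", Ably p. 29).
* `sum_natCast_mul_injective` — the frequencies `h ↦ h·y = ∑ hᵢ yᵢ` (`h ∈ ℕⁿ`) are pairwise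
  distinct (Ably p. 40, second case of Lemme 3: "`card((Γ̃(M/2) + G')/G') ≥ [M/2]ⁿ`", which is
  this injectivity), and `aeval_cexp_eq_sum` — `P(e^{y}) = ∑_h p_h e^{h·y}`, the exponential-sum
  form of the value (Ably p. 34, `M_{β,γ,h,s}(θ) = Δ_s M_{β,γ}(h·y, e^{h·y})` with `θᵢ = e^{yᵢ}`).
* the DEGENERATE RANGES of the Lean statement, which the printed theorem does not need to mention
  (`P` "de degré `≤ D` et de hauteur `≤ H`" with `P` non-constant in every use): a non-zero
  constant `P` has `|P(θ)| ≥ 1` (`one_le_norm_aeval_of_totalDegree_eq_zero`), the left-hand side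
  `exp(−c₂ Dⁿ (log H + e^{C Dⁿ log(D+1)}))` is `≤ 1` as soon as `c₂ ≥ 0` and `H ≥ 1`
  (`ablyBound_le_one`), `H ≥ 1` is forced by `P ≠ 0` (`one_le_of_coeff_abs_le`), so the
  inequality holds for constant `P` (`ablyBound_le_norm_aeval_of_totalDegree_eq_zero`), in
  particular whenever `D = 0` or `n = 0`; and the whole statement holds outright for `n = 0`
  (`ably1994_measure_fin_zero`).

What is NOT here: the measure for `n ≥ 1`, `D ≥ 1` (parts I–III of the printed proof).

## References

* [Ably1994] M. Ably, *Une version quantitative du théorème de Lindemann–Weierstrass*, Acta Arith.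
  67 (1994) 29–45: Théorème (p. 30), §II 1er pas (p. 34), Lemme 3 (pp. 39–40).
* [BakerTNT1975] A. Baker, *Transcendental Number Theory*, CUP 1975, Ch. 1 §3, Theorem 1.4 and the
  remark following it (Weierstrass' form), p. 6.
-/

noncomputable section

open Complex MvPolynomial Finset

namespace Literature.NumberTheory.Transcendental

namespace Ably1994

variable {n : ℕ}

/-! ### The sign of the theorem: Lindemann–Weierstrass -/

/-- **`P(e^{y₁}, …, e^{yₙ}) ≠ 0`** for `ℚ`-linearly independent algebraic `y₁, …, yₙ` and a
non-zero `P ∈ ℤ[X₁, …, Xₙ]` — the Lindemann–Weierstrass theorem in Weierstrass' form (the tree's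
`LindemannWeierstrass.AlgIndep_holds`), read for integer polynomials through the injection
`ℤ[X] ↪ ℚ[X]`. This is the qualitative content of Ably's measure.
[cite: BakerTNT1975, Ch. 1 §3, remark after Theorem 1.4, p. 6] -/
theorem aeval_cexp_ne_zero (y : Fin n → ℂ) (halg : ∀ i, IsAlgebraic ℚ (y i))
    (hli : LinearIndependent ℚ y) {P : MvPolynomial (Fin n) ℤ} (hP : P ≠ 0) :
    MvPolynomial.aeval (fun i => cexp (y i)) P ≠ 0 := by
  have hind : AlgebraicIndependent ℚ (cexp ∘ y) := LindemannWeierstrass.AlgIndep_holds n y halg hli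
  -- `aeval (cexp ∘ y)` is injective on `ℚ[X]`
  have hinj := algebraicIndependent_iff_injective_aeval.mp hind
  have hmap : MvPolynomial.map (algebraMap ℤ ℚ) P ≠ 0 := fun h =>
    hP (MvPolynomial.map_injective (algebraMap ℤ ℚ) (algebraMap ℤ ℚ).injective_int
      (by rw [h, map_zero]))
  intro h0
  apply hmap
  apply hinj
  change MvPolynomial.aeval (cexp ∘ y) (MvPolynomial.map (algebraMap ℤ ℚ) P) =
    MvPolynomial.aeval (cexp ∘ y) 0
  rw [MvPolynomial.aeval_map_algebraMap, map_zero]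
  exact h0

/-- `0 < |P(e^{y₁}, …, e^{yₙ})|` under the hypotheses of Ably's theorem (Lindemann–Weierstrass).
[cite: BakerTNT1975, Ch. 1 §3, remark after Theorem 1.4, p. 6] -/
theorem norm_aeval_cexp_pos (y : Fin n → ℂ) (halg : ∀ i, IsAlgebraic ℚ (y i))
    (hli : LinearIndependent ℚ y) {P : MvPolynomial (Fin n) ℤ} (hP : P ≠ 0) :
    0 < ‖MvPolynomial.aeval (fun i => cexp (y i)) P‖ :=
  norm_pos_iff.mpr (aeval_cexp_ne_zero y halg hli hP)

/-! ### The frequencies `h·y` and the exponential-sum form of `P(e^y)` -/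

/-- For `ℚ`-linearly independent `y₁, …, yₙ` the map `h ↦ h·y = ∑ hᵢ yᵢ` is injective on `ℕⁿ`
(the points `h·y` of Ably's construction are pairwise distinct; this is the count
`card ≥ [M/2]ⁿ` in the second case of Lemme 3). [cite: Ably1994, Lemme 3, second case (p. 40)] -/
theorem sum_natCast_mul_injective (y : Fin n → ℂ) (hli : LinearIndependent ℚ y) :
    Function.Injective fun h : Fin n → ℕ => ∑ i, (h i : ℂ) * y i := by
  intro h h' heq
  have hzero : ∑ i, ((h i : ℚ) - (h' i : ℚ)) • y i = 0 := by
    simp only [sub_smul, Finset.sum_sub_distrib, Rat.smul_def, Rat.cast_natCast]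
    exact sub_eq_zero.mpr heq
  have hcoef := Fintype.linearIndependent_iff.mp hli (fun i => (h i : ℚ) - (h' i : ℚ)) hzero
  funext i
  have := hcoef i
  exact_mod_cast sub_eq_zero.mp this

/-- **The exponential-sum form of the value**: `P(e^{y₁}, …, e^{yₙ}) = ∑_h p_h · e^{h·y}`, the sum
over the support of `P = ∑_h p_h X^h` (`e^{h·y} = ∏ᵢ (e^{yᵢ})^{hᵢ}`).
[cite: Ably1994, §II 1er pas (p. 34: `M_{β,γ,h,s}(θ) = Δ_s M_{β,γ}(h·y, e^{h·y})`)] -/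
theorem aeval_cexp_eq_sum (y : Fin n → ℂ) (P : MvPolynomial (Fin n) ℤ) :
    MvPolynomial.aeval (fun i => cexp (y i)) P =
      ∑ h ∈ P.support, ((P.coeff h : ℤ) : ℂ) * cexp (∑ i, (h i : ℂ) * y i) := by
  rw [MvPolynomial.aeval_def, MvPolynomial.eval₂_eq']
  refine Finset.sum_congr rfl fun h _ => ?_
  congr 1
  rw [Complex.exp_sum]
  refine Finset.prod_congr rfl fun i _ => ?_
  rw [← Complex.exp_nat_mul]

/-! ### The degenerate ranges of the statement -/

/-- A non-zero CONSTANT integer polynomial has `|P(θ)| ≥ 1` at every point. [folklore] -/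
theorem one_le_norm_aeval_of_totalDegree_eq_zero {σ : Type*} (θ : σ → ℂ)
    {P : MvPolynomial σ ℤ} (hP : P ≠ 0) (hdeg : P.totalDegree = 0) :
    1 ≤ ‖MvPolynomial.aeval θ P‖ := by
  rw [MvPolynomial.totalDegree_eq_zero_iff_eq_C] at hdeg
  rw [hdeg, MvPolynomial.aeval_C, eq_intCast, norm_intCast]
  have h0 : P.coeff 0 ≠ 0 := fun h => hP (by rw [hdeg, h, map_zero])
  exact_mod_cast Int.one_le_abs h0

/-- If all coefficients of `P` are bounded by `H` in absolute value and `P ≠ 0`, then `H ≥ 1`.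
[folklore] -/
theorem one_le_of_coeff_abs_le {σ : Type*} {P : MvPolynomial σ ℤ} (hP : P ≠ 0) {H : ℕ}
    (hH : ∀ m, |P.coeff m| ≤ (H : ℤ)) : 1 ≤ H := by
  obtain ⟨m, hm⟩ := MvPolynomial.ne_zero_iff.mp hP
  have := (Int.one_le_abs hm).trans (hH m)
  exact_mod_cast this

/-- **The left-hand side of Ably's inequality is at most `1`**: for `c₂ ≥ 0`, `H ≥ 1` and any
real `C`, `exp(−c₂ Dⁿ (log H + e^{C Dⁿ log(D+1)})) ≤ 1`. [folklore] -/
theorem ablyBound_le_one {c₂ C : ℝ} (hc₂ : 0 ≤ c₂) (n D : ℕ) {H : ℕ} (hH : 1 ≤ H) :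
    Real.exp (-(c₂ * (D : ℝ) ^ n *
        (Real.log H + Real.exp (C * (D : ℝ) ^ n * Real.log ((D : ℝ) + 1))))) ≤ 1 := by
  rw [Real.exp_le_one_iff, neg_nonpos]
  have hlog : 0 ≤ Real.log H := Real.log_nonneg (by exact_mod_cast hH)
  positivity

/-- **The inequality for a constant `P`** (in particular whenever `D = 0`, or `n = 0`): for
`c₂ ≥ 0`, a non-zero `P` of total degree `0` with coefficients bounded by `H` satisfies Ably's
inequality, because its left-hand side is `≤ 1 ≤ |P(θ)|`. [folklore] -/
theorem ablyBound_le_norm_aeval_of_totalDegree_eq_zero {c₂ C : ℝ} (hc₂ : 0 ≤ c₂) (θ : Fin n → ℂ)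
    {P : MvPolynomial (Fin n) ℤ} (hP : P ≠ 0) (hdeg : P.totalDegree = 0) (D : ℕ) {H : ℕ}
    (hH : ∀ m, |P.coeff m| ≤ (H : ℤ)) :
    Real.exp (-(c₂ * (D : ℝ) ^ n *
        (Real.log H + Real.exp (C * (D : ℝ) ^ n * Real.log ((D : ℝ) + 1))))) ≤
      ‖MvPolynomial.aeval θ P‖ :=
  (ablyBound_le_one hc₂ n D (one_le_of_coeff_abs_le hP hH)).trans
    (one_le_norm_aeval_of_totalDegree_eq_zero θ hP hdeg)

/-- Over `Fin 0` every polynomial is constant: `P.totalDegree = 0`. [folklore] -/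
theorem totalDegree_eq_zero_fin_zero (P : MvPolynomial (Fin 0) ℤ) : P.totalDegree = 0 := by
  refine Nat.eq_zero_of_le_zero (Finset.sup_le fun m _ => ?_)
  -- every exponent vector over `Fin 0` is `0`
  have hm : m = 0 := Finsupp.ext fun i => Fin.elim0 i
  simp [hm]

/-- **Ably's statement for `n = 0`** holds outright (there `P` is a non-zero integer constant):
the instance `n = 0` of `Ably1994_lindemannWeierstrass_measure`, with `C = c₂ = 1`. [folklore] -/
theorem ably1994_measure_fin_zero (y : Fin 0 → ℂ) :
    ∃ C c₂ : ℝ, 0 < C ∧ 0 < c₂ ∧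
      ∀ (P : MvPolynomial (Fin 0) ℤ) (D H : ℕ), P ≠ 0 → P.totalDegree ≤ D →
        (∀ m, |P.coeff m| ≤ (H : ℤ)) →
          Real.exp (-(c₂ * (D : ℝ) ^ (0 : ℕ) *
              (Real.log H + Real.exp (C * (D : ℝ) ^ (0 : ℕ) * Real.log ((D : ℝ) + 1))))) ≤
            ‖MvPolynomial.aeval (fun i => cexp (y i)) P‖ :=
  ⟨1, 1, one_pos, one_pos, fun P D _H hP _ hH =>
    ablyBound_le_norm_aeval_of_totalDegree_eq_zero zero_le_one _ hP
      (totalDegree_eq_zero_fin_zero P) D hH⟩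

/-- **The inequality in the range `D = 0`** (any `n`): `P.totalDegree ≤ 0` makes `P` constant.
[folklore] -/
theorem ablyBound_le_norm_aeval_of_le_zero {c₂ C : ℝ} (hc₂ : 0 ≤ c₂) (θ : Fin n → ℂ)
    {P : MvPolynomial (Fin n) ℤ} (hP : P ≠ 0) (hdeg : P.totalDegree ≤ 0) {H : ℕ}
    (hH : ∀ m, |P.coeff m| ≤ (H : ℤ)) :
    Real.exp (-(c₂ * ((0 : ℕ) : ℝ) ^ n *
        (Real.log H + Real.exp (C * ((0 : ℕ) : ℝ) ^ n * Real.log (((0 : ℕ) : ℝ) + 1))))) ≤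
      ‖MvPolynomial.aeval θ P‖ :=
  ablyBound_le_norm_aeval_of_totalDegree_eq_zero hc₂ θ hP (Nat.eq_zero_of_le_zero hdeg) 0 hH

end Ably1994

end Literature.NumberTheory.Transcendental

end
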